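import Mathlib
import Summits.PneNP.PneNP.Theses.PrimalityPlaces
import Summits.PneNP.PneNP.Theorems.PrimalityWidthHard.Negative.BalancedCNFWidthFourSetup

/-!
# `PrimalityWidthHard` is false at the low edge of the prime range (negative lemma modulo
# `LowEdgePrimesIO`; crux `stmt-PneNP-16924`, route `PrimalityPlaces`, crux-attack at birth)

The crux `Summit.PneNP.PneNP.Theses.PrimalityPlaces.PrimalityWidthHard` asserts a resolution-width
lower bound `ε·n` for `balancedCNF n p` for EVERY prime `p ∈ [4^(n-1), 4^n)`. But the balance units
`x_{n-1} = y_{n-1} = 1` together with `x_0 = 1` (forced by `p` odd through `Z_0 = PP 0 0`) give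
`x·y ≥ (2^(n-1)+1)·2^(n-1) = 4^(n-1) + 2^(n-1)`, so a prime `p < 4^(n-1) + 2^(n-1)` is excluded by
MAGNITUDE, and resolution sees this in width 4 (= the initial width, the minimum possible) and size
`O(n²)`:

* `lowEdge_refutation_width_four`: for `2 ≤ n` and any `p` whose bits `n-1 … 2n-3` and `2n-1` are `0`
  and whose bit `0` is `1` (in particular `p` odd with `4^(n-1) ≤ p < 4^(n-1) + 2^(n-1)`,
  `bits_of_lowEdge`), `balancedCNF n p` has a resolution refutation of width `≤ 4`. The refutation
  (`sweep`) propagates "this wire is 0" from the zero output bits backwards through every full adder of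
  the columns `≥ n-1` (sum 0 and carry-out 0 force all three inputs 0, `cell_inputs_false` of the setup
  file), reaching `PP 0 (n-1) = x_0 ∧ y_{n-1} = 0`, against the units `y_{n-1} = 1` and `x_0 = 1`.
  Checked independently by a Python replay of every resolution step for `n = 2 … 13` and all low-edge
  primes (1648 lines at `n = 13`; refuter folder `py/width4.py`).
* `primalityWidthHard_false_of_lowEdgePrimesIO`: hence `LowEdgePrimesIO → ¬ PrimalityWidthHard`, where
  `LowEdgePrimesIO` says that for infinitely many `n` there is a prime in `[4^(n-1), 4^(n-1)+2^(n-1))`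
  — Oppermann's conjecture (a prime in `(m², m²+m)`) at infinitely many `m = 2^(n-1)`; numerically
  there are 1, 2, 2, 4, 5, 9, 12, 30, 42, 77, 137, 249 such primes for `n = 2 … 13`, but no proof of
  `LowEdgePrimesIO` (nor of its negation) is known, so the crux is refuted only MODULO it and stays open.

Repair for the planner (the defect is a missing side condition — "refuted-misstated" in spirit): keep
`p` a constant factor away from both edges of the product range `[(2^(n-1)+1)², (2^n-1)²]`, e.g.
`2·4^(n-1) ≤ p < 3·4^(n-1)`; the witness does not touch that range. The same defect is in
`ResolutionCannotProvePrimality` (stmt-PneNP-16923: the refutation below has `O(n²)` lines) and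
`TreeLikePrimalityHard` (stmt-PneNP-16930: the same propagation is a DPLL caterpillar of size `O(n²)`,
one branch per cell closing by unit propagation).
-/

-- `Summit.<Summit>.<Problem>`: for the single-conjunct summit `PneNP` the duplicate `PneNP.PneNP` is mandated.
set_option linter.dupNamespace false

namespace Summit.PneNP.PneNP.Theorems.PrimalityWidthHard.Negative

open Literature.Computability.Complexity Literature.Computability.MetaComplexity

/-! ### The backward sweep over the cells of columns `≥ n - 1` -/

section Sweep

variable {n p : ℕ}

/-- One cell of the sweep from its sum and carry-out: the inputs of cell `(i, j)` are all
(derivably) `0`. [folklore] -/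
theorem cellZero_of {i j : ℕ} (hi0 : i ≠ 0) (hi : i < n) (hj : j < n)
    (hs : NarrowDerivable (balancedCNF n p) 4 {(vS n i (i + j), false)})
    (hm : NarrowDerivable (balancedCNF n p) 4 {(vC n i (j + 1), false)}) :
    NarrowDerivable (balancedCNF n p) 4 {(acc n (i - 1) (i + j), false)} ∧
      NarrowDerivable (balancedCNF n p) 4 {(vPP n i j, false)} ∧
        NarrowDerivable (balancedCNF n p) 4 {(cin n i j, false)} :=
  cell_inputs_false (fun _ h => xor_mem hi0 hi hj h) (fun _ h => maj_mem hi0 hi hj h) hs hm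

/-- The corner cell `(n-1, n-1)`: `PP = x_{n-1} ∧ y_{n-1} = 1`, carry-out `Z_{2n-1} = 0`. [folklore] -/
theorem corner (hn : 2 ≤ n) (htop : Nat.testBit p (2 * n - 1) = false) :
    NarrowDerivable (balancedCNF n p) 4 {(acc n (n - 1 - 1) (n - 1 + (n - 1)), false)} ∧
      NarrowDerivable (balancedCNF n p) 4 {(cin n (n - 1) (n - 1), false)} := by
  have hbT : NarrowDerivable (balancedCNF n p) 4 {(vPP n (n - 1) (n - 1), true)} := by
    have A3 : NarrowDerivable (balancedCNF n p) 4
        {(vPP n (n - 1) (n - 1), true), (vX (n - 1), false), (vY n (n - 1), false)} :=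
      nd_ax _ (and_mem (i := n - 1) (j := n - 1) (by omega) (by omega)
        (cl := [(vPP n (n - 1) (n - 1), true), (vX (n - 1), false), (vY n (n - 1), false)])
        (by simp [andCl]))
    have h1 : NarrowDerivable (balancedCNF n p) 4
        {(vPP n (n - 1) (n - 1), true), (vY n (n - 1), false)} :=
      nd_res (vX (n - 1)) _ (nd_ax {(vX (n - 1), true)} xtop_mem) A3
    exact nd_res (vY n (n - 1)) _ (nd_ax {(vY n (n - 1), true)} ytop_mem) h1
  have hmF : NarrowDerivable (balancedCNF n p) 4 {(vC n (n - 1) (n - 1 + 1), false)} := by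
    have h := outF (n := n) (p := p) (k := 2 * n - 1) (by omega) htop
    have e : vZ n (2 * n - 1) = vC n (n - 1) (n - 1 + 1) := by
      rw [Nat.sub_add_cancel (by omega : 1 ≤ n)]
      unfold vZ
      exact acc_C n (by omega) (by omega)
    rwa [e] at h
  exact corner_inputs_false (fun _ h => maj_mem (i := n - 1) (j := n - 1) (by omega) (by omega) (by omega) h)
    hbT hmF

/-- The sweep: every cell `(n-1-d, n-1-e)` with `d + e ≤ n - 1`, `d ≤ n - 2`, other than the
corner, has all inputs `0`, provided the output bits `n-1 … 2n-3` and `2n-1` of `p` vanish.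
Induction on `d` (rows, bottom-up), then on `e` (columns, right to left). [folklore] -/
theorem sweep (hn : 2 ≤ n) (hmid : ∀ k, n - 1 ≤ k → k ≤ 2 * n - 3 → Nat.testBit p k = false)
    (htop : Nat.testBit p (2 * n - 1) = false) :
    ∀ d, d ≤ n - 2 → ∀ e, d + e ≤ n - 1 → (d ≠ 0 ∨ e ≠ 0) →
      NarrowDerivable (balancedCNF n p) 4
          {(acc n (n - 1 - d - 1) (n - 1 - d + (n - 1 - e)), false)} ∧
        NarrowDerivable (balancedCNF n p) 4 {(vPP n (n - 1 - d) (n - 1 - e), false)} ∧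
          NarrowDerivable (balancedCNF n p) 4 {(cin n (n - 1 - d) (n - 1 - e), false)} := by
  have hcorner := corner (n := n) (p := p) hn htop
  intro d
  induction d with
  | zero =>
    intro _ e
    induction e with
    | zero => intro _ h; simp at h
    | succ e ihe =>
      intro hde _
      -- cell (n-1, n-2-e): sum is the output bit n-1+(n-2-e) ∈ [n-1, 2n-3]
      have hs : NarrowDerivable (balancedCNF n p) 4
          {(vS n (n - 1 - 0) (n - 1 - 0 + (n - 1 - (e + 1))), false)} := by
        have h := outF (n := n) (p := p) (k := n - 1 - 0 + (n - 1 - (e + 1))) (by omega)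
          (hmid _ (by omega) (by omega))
        unfold vZ at h
        rwa [acc_S n (by omega) (by omega) (by omega)] at h
      have hm : NarrowDerivable (balancedCNF n p) 4
          {(vC n (n - 1 - 0) (n - 1 - (e + 1) + 1), false)} := by
        rcases Nat.eq_zero_or_pos e with he | he
        · subst he
          have h := hcorner.2
          rw [cin_ne n (by omega)] at h
          have e1 : n - 1 - (0 + 1) + 1 = n - 1 := by omega
          rw [e1]
          simpa using h
        · have h := (ihe (by omega) (Or.inr (by omega))).2.2
          rw [cin_ne n (by omega)] at h
          have e1 : n - 1 - (e + 1) + 1 = n - 1 - e := by omega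
          rwa [e1]
      exact cellZero_of (by omega) (by omega) (by omega) hs hm
  | succ d ihd =>
    intro hd e
    induction e with
    | zero =>
      intro hde _
      -- cell (i, n-1) with i = n-2-d ≥ 1: sum from cell (i+1, n-2), carry-out from cell (i+1, n-1)
      have hs : NarrowDerivable (balancedCNF n p) 4
          {(vS n (n - 1 - (d + 1)) (n - 1 - (d + 1) + (n - 1 - 0)), false)} := by
        have h := (ihd (by omega) 1 (by omega) (Or.inr one_ne_zero)).1
        have e1 : n - 1 - d - 1 = n - 1 - (d + 1) := by omega
        have e2 : n - 1 - d + (n - 1 - 1) = n - 1 - (d + 1) + (n - 1 - 0) := by omega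
        rw [e1, e2, acc_S n (by omega) (by omega) (by omega)] at h
        exact h
      have hm : NarrowDerivable (balancedCNF n p) 4
          {(vC n (n - 1 - (d + 1)) (n - 1 - 0 + 1), false)} := by
        rcases Nat.eq_zero_or_pos d with hd0 | hd0
        · subst hd0
          have h := hcorner.1
          have e1 : n - 1 - 1 = n - 1 - (0 + 1) := by omega
          rw [e1, acc_C n (by omega) (by omega)] at h
          have e2 : n - 1 - 0 + 1 = n := by omega
          rwa [e2]
        · have h := (ihd (by omega) 0 (by omega) (Or.inl (by omega))).1
          have e1 : n - 1 - d - 1 = n - 1 - (d + 1) := by omega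
          rw [e1, acc_C n (by omega) (by omega)] at h
          have e2 : n - 1 - 0 + 1 = n := by omega
          rwa [e2]
      exact cellZero_of (by omega) (by omega) (by omega) hs hm
    | succ e ihe =>
      intro hde _
      -- cell (i, j) with i = n-2-d ≥ 1, j = n-2-e ≤ n-2
      have hs : NarrowDerivable (balancedCNF n p) 4
          {(vS n (n - 1 - (d + 1)) (n - 1 - (d + 1) + (n - 1 - (e + 1))), false)} := by
        have h := (ihd (by omega) (e + 1 + 1) (by omega) (Or.inr (by omega))).1
        have e1 : n - 1 - d - 1 = n - 1 - (d + 1) := by omega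
        have e2 : n - 1 - d + (n - 1 - (e + 1 + 1)) = n - 1 - (d + 1) + (n - 1 - (e + 1)) := by omega
        rw [e1, e2, acc_S n (by omega) (by omega) (by omega)] at h
        exact h
      have hm : NarrowDerivable (balancedCNF n p) 4
          {(vC n (n - 1 - (d + 1)) (n - 1 - (e + 1) + 1), false)} := by
        have h := (ihe (by omega) (Or.inl (by omega))).2.2
        rw [cin_ne n (by omega)] at h
        have e1 : n - 1 - (e + 1) + 1 = n - 1 - e := by omega
        rwa [e1]
      exact cellZero_of (by omega) (by omega) (by omega) hs hm

/-- **Width 4 at the low edge.** For `2 ≤ n` and `p` with bit `0` set, bits `n-1 … 2n-3` and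
`2n-1` clear (bit `2n-2` is not even needed), `balancedCNF n p` has a resolution refutation of
width `≤ 4`. [folklore] -/
theorem lowEdge_refutation_width_four (hn : 2 ≤ n) (h0 : Nat.testBit p 0 = true)
    (hmid : ∀ k, n - 1 ≤ k → k ≤ 2 * n - 3 → Nat.testBit p k = false)
    (htop : Nat.testBit p (2 * n - 1) = false) :
    ∃ π : List (ResLine ℕ), IsResRefutation (balancedCNF n p) π ∧ resWidth π ≤ 4 := by
  apply exists_refutation_of_nd_empty
  -- `PP 0 (n-1) = 0` from the sweep at cell (1, n-2)
  have hPP : NarrowDerivable (balancedCNF n p) 4 {(vPP n 0 (n - 1), false)} := by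
    have h := (sweep hn hmid htop (n - 2) le_rfl 1 (by omega) (Or.inr one_ne_zero)).1
    have e1 : n - 1 - (n - 2) - 1 = 0 := by omega
    have e2 : n - 1 - (n - 2) + (n - 1 - 1) = n - 1 := by omega
    rw [e1, e2, acc_zero n (by omega)] at h
    exact h
  -- hence `x_0 = 0` (as `y_{n-1} = 1`)
  have hx0F : NarrowDerivable (balancedCNF n p) 4 {(vX 0, false)} := by
    have A3 : NarrowDerivable (balancedCNF n p) 4
        {(vPP n 0 (n - 1), true), (vX 0, false), (vY n (n - 1), false)} :=
      nd_ax _ (and_mem (i := 0) (j := n - 1) (by omega) (by omega)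
        (cl := [(vPP n 0 (n - 1), true), (vX 0, false), (vY n (n - 1), false)]) (by simp [andCl]))
    have h1 : NarrowDerivable (balancedCNF n p) 4 {(vX 0, false), (vY n (n - 1), false)} :=
      nd_res (vPP n 0 (n - 1)) _ A3 hPP
    exact nd_res (vY n (n - 1)) _ (nd_ax {(vY n (n - 1), true)} ytop_mem) h1
  -- but `x_0 = 1` (as `Z_0 = PP 0 0 = 1`, `p` odd)
  have hx0T : NarrowDerivable (balancedCNF n p) 4 {(vX 0, true)} := by
    have hz : NarrowDerivable (balancedCNF n p) 4 {(vPP n 0 0, true)} := by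
      have h := outT (n := n) (p := p) (k := 0) (by omega) h0
      rwa [vZ_zero n hn] at h
    exact nd_res (vPP n 0 0) _ hz
      (nd_ax {(vPP n 0 0, false), (vX 0, true)} (and_mem (i := 0) (j := 0) (by omega) (by omega)
        (cl := [(vPP n 0 0, false), (vX 0, true)]) (by simp [andCl])))
  exact nd_res (vX 0) ∅ hx0T hx0F

/-- Sanity instance: `n = 3`, `p = 17` (prime, `16 ≤ 17 < 20`): a width-4 refutation exists. -/
example : ∃ π : List (ResLine ℕ), IsResRefutation (balancedCNF 3 17) π ∧ resWidth π ≤ 4 :=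
  lowEdge_refutation_width_four (n := 3) (p := 17) (by norm_num) (by decide)
    (fun k hk1 hk2 => by
      obtain rfl | rfl : k = 2 ∨ k = 3 := by omega
      all_goals decide)
    (by decide)

end Sweep

/-! ### From the interval `[4^(n-1), 4^(n-1) + 2^(n-1))` to the bit pattern -/

/-- `4^(n-1) = 2^(2n-2)` for `n ≥ 1`. [folklore] -/
theorem four_pow_eq (n : ℕ) (hn : 1 ≤ n) : (4 : ℕ) ^ (n - 1) = 2 ^ (2 * n - 2) := by
  rw [show (4 : ℕ) = 2 ^ 2 from rfl, ← pow_mul]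
  congr 1
  omega

/-- The bit pattern of an odd `p ∈ [4^(n-1), 4^(n-1) + 2^(n-1))`: bit `0` set, bits `n-1 … 2n-3`
and `2n-1` clear. [folklore] -/
theorem bits_of_lowEdge {n p : ℕ} (hn : 2 ≤ n) (hodd : Odd p) (h1 : 4 ^ (n - 1) ≤ p)
    (h2 : p < 4 ^ (n - 1) + 2 ^ (n - 1)) :
    Nat.testBit p 0 = true ∧ (∀ k, n - 1 ≤ k → k ≤ 2 * n - 3 → Nat.testBit p k = false) ∧
      Nat.testBit p (2 * n - 1) = false := by
  rw [four_pow_eq n (by omega)] at h1 h2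
  refine ⟨?_, ?_, ?_⟩
  · rw [Nat.testBit_zero]  -- p.testBit 0 = decide (p % 2 = 1)
    obtain ⟨r, hr⟩ := hodd
    subst hr
    simp [Nat.add_mod]
  · intro k hk1 hk2
    rw [Nat.testBit_eq_decide_div_mod_eq]
    have hc : p - 2 ^ (2 * n - 2) < 2 ^ k :=
      lt_of_lt_of_le (by omega) (Nat.pow_le_pow_right (by norm_num) (by omega : n - 1 ≤ k))
    have hdiv : p / 2 ^ k = 2 ^ (2 * n - 2 - k) := by
      have hp : p = 2 ^ (2 * n - 2 - k) * 2 ^ k + (p - 2 ^ (2 * n - 2)) := by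
        rw [← pow_add, show 2 * n - 2 - k + k = 2 * n - 2 by omega]
        omega
      rw [hp, Nat.add_comm, Nat.add_mul_div_right _ _ (by positivity), Nat.div_eq_of_lt hc,
        Nat.zero_add]
    rw [hdiv]
    have : 2 ^ (2 * n - 2 - k) % 2 = 0 := by
      rw [show 2 * n - 2 - k = (2 * n - 3 - k) + 1 by omega, pow_succ]
      simp
    simp [this]
  · rw [Nat.testBit_eq_decide_div_mod_eq]
    have : p / 2 ^ (2 * n - 1) = 0 := by
      apply Nat.div_eq_of_lt
      calc p < 2 ^ (2 * n - 2) + 2 ^ (n - 1) := h2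
        _ ≤ 2 ^ (2 * n - 2) + 2 ^ (2 * n - 2) :=
          Nat.add_le_add_left (Nat.pow_le_pow_right (by norm_num) (by omega)) _
        _ = 2 ^ (2 * n - 1) := by rw [← two_mul, ← pow_succ', show 2 * n - 2 + 1 = 2 * n - 1 by omega]
    simp [this]

/-! ### The hypothesis and the negative lemma -/

/-- **Hypothesis `LowEdgePrimesIO` (Oppermann's conjecture at infinitely many powers of two; NOT
proved, NOT refuted, not in the tree).** For infinitely many `n` there is a prime `p` with
`4^(n-1) ≤ p < 4^(n-1) + 2^(n-1)`, i.e. a prime in `[m², m² + m)` for `m = 2^(n-1)`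
(Oppermann 1882 conjectures a prime in `(m², m² + m)` for every `m > 1`; even under RH only
intervals `[x, x + x^{1/2} log x]` are reached; the best unconditional exponent is `0.525`,
Baker–Harman–Pintz 2001). Numerically the number of such primes is 1, 2, 2, 4, 5, 9, 12, 30, 42,
77, 137, 249 for `n = 2, …, 13` (heuristically `~ 2^(n-1) / ((2n-2) log 2)`). HYPOTHESIS of the
negative lemma `primalityWidthHard_false_of_lowEdgePrimesIO` (filed `--negative-modulo
LowEdgePrimesIO`); not a Literature fact. [topic NumberTheory.PrimesInShortIntervals] -/
def LowEdgePrimesIO : Prop :=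
  ∀ N : ℕ, ∃ n ≥ N, ∃ p : ℕ, p.Prime ∧ 4 ^ (n - 1) ≤ p ∧ p < 4 ^ (n - 1) + 2 ^ (n - 1)

/-- **`PrimalityWidthHard` fails modulo `LowEdgePrimesIO`.** Every prime in the low edge
`[4^(n-1), 4^(n-1) + 2^(n-1))` of the crux's range has a width-4 refutation
(`lowEdge_refutation_width_four`), so no `ε·n` width lower bound can hold for all primes in
`[4^(n-1), 4^n)` once such primes exist for arbitrarily large `n`. Repair: bound `p` away from the
edges of the product range, e.g. `2·4^(n-1) ≤ p < 3·4^(n-1)`. [folklore] -/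
theorem primalityWidthHard_false_of_lowEdgePrimesIO (H : LowEdgePrimesIO) :
    ¬ Summit.PneNP.PneNP.Theses.PrimalityPlaces.PrimalityWidthHard := by
  rw [primalityWidthHard_iff]
  rintro ⟨ε, hε, N, hN⟩
  obtain ⟨M, hM⟩ := exists_nat_gt (4 / ε)
  obtain ⟨n, hn, p, hp, h1, h2⟩ := H (max N (max M 2))
  have hnN : N ≤ n := le_trans (le_max_left _ _) hn
  have hnM : M ≤ n := le_trans ((le_max_left _ _).trans (le_max_right _ _)) hn
  have hn2 : 2 ≤ n := le_trans ((le_max_right _ _).trans (le_max_right _ _)) hn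
  have hp4 : p < 4 ^ n := by
    have h4 : (4 : ℕ) ^ n = 4 * 4 ^ (n - 1) := by
      rw [← pow_succ', Nat.sub_add_cancel (by omega : 1 ≤ n)]
    have h24 : (2 : ℕ) ^ (n - 1) ≤ 4 ^ (n - 1) := Nat.pow_le_pow_left (by norm_num) _
    omega
  have hodd : Odd p := hp.odd_of_ne_two (by
    have : (4 : ℕ) ≤ 4 ^ (n - 1) := by
      calc (4 : ℕ) = 4 ^ 1 := by norm_num
        _ ≤ 4 ^ (n - 1) := Nat.pow_le_pow_right (by norm_num) (by omega)
    omega)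
  obtain ⟨hb0, hmid, htop⟩ := bits_of_lowEdge hn2 hodd h1 h2
  obtain ⟨π, hπ, hw⟩ := lowEdge_refutation_width_four hn2 hb0 hmid htop
  have hle := hN n hnN p hp h1 hp4 π hπ
  have hw' : (resWidth π : ℝ) ≤ 4 := by exact_mod_cast hw
  have hM' : (M : ℝ) ≤ n := by exact_mod_cast hnM
  have h4 : 4 < ε * M := by
    have := (div_lt_iff₀ hε).1 hM
    linarith [this]
  nlinarith [mul_le_mul_of_nonneg_left hM' hε.le]

end Summit.PneNP.PneNP.Theorems.PrimalityWidthHard.Negative
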